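import Literature.Analysis.FluidPDE.WholeSpaceIBP
import HarnessLib

/-!
# Lieberman's expanding-paraboloid barrier for `Δ − Λ₁|∇| − ∂ₜ`

Analysis/FluidPDE proofs file (theorems only). It supplies the explicit comparison function of
Lieberman, *Second Order Parabolic Differential Equations* (1996), Ch. II, proof of Lemma 2.6
(pp. 10–11), specialised to the heat operator with a bounded drift of size `Λ₁ = A` on a
finite-dimensional real inner product space `E` of dimension `n`:

  `ψ(t, x) = (P(t) − |x − y|²)² / P(t)^q`,  `P(t) = p₀ + m (t − t_b)`  (`p₀ = ε²R²`,
  `m = (1 − ε²)/α` in Lieberman's normalisation, `ψ₀ = P`, `ψ₁ = P − |x − y|²`),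

on the expanding paraboloid `{|x − y|² < P(t)}`. The calculus facts proved here are:

* `hasFDerivAt_paraboloidBarrier` — `Dψ(t,·)(x) = −4 (P − |x−y|²) P^{-q} ⟨x − y, ·⟩`;
* `laplacian_paraboloidBarrier` — `Δψ(t,·)(x) = (8|x−y|² − 4n(P − |x−y|²)) P^{-q}` (Lieberman:
  `8aⁱʲxᵢxⱼ − 4ψ₁𝒯` with `aⁱʲ = δⁱʲ`, `𝒯 = n`);
* `hasDerivAt_paraboloidBarrier_time` — `∂ₜψ = m (2(P − r) − q(P − r)²/P) P^{-q}`, `r = |x−y|²`;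
* `paraboloidBarrier_ineq` — the algebra of Lieberman's choice of `q`: with
  `F = 8 + 4n + 4Λ₁R + 2m` and `32 m q ≥ F²`, for `0 ≤ S ≤ P ≤ R²`-type configurations
  `m(2S − qS²/P) ≤ 8(P − S) − 4nS − 4Λ₁ S R`, i.e. `Δψ − Λ₁|Dψ| − ∂ₜψ ≥ 0` inside the paraboloid
  (Lieberman: "By choosing `q = 2 + α F₁²λ/(32(1 − ε²))` we see that `Lψ ≥ 0` in `Q`").

These feed the comparison argument of `ParabolicComparison` and the spreading-of-positivity lemma
of `KNSSLemma21` (KNSS 2009, Lemma 2.1). Everything is elementary calculus; nothing is assumed.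

## References

* G. M. Lieberman, *Second Order Parabolic Differential Equations*, World Scientific (1996),
  Ch. II §2, Lemma 2.6 and its proof (pp. 10–11). [Lieberman1996]
-/

noncomputable section

open MeasureTheory Set Function Filter TopologicalSpace InnerProductSpace Metric
open scoped RealInnerProductSpace Laplacian ContDiff Topology

namespace Literature.Analysis.FluidPDE

variable {E : Type*} [NormedAddCommGroup E] [InnerProductSpace ℝ E]

/-! ### Space derivatives of `x ↦ (c₁ − |x − y|²)² / c₂` -/

section Space

/-- `D(|· − y|²)(x) = 2⟨x − y, ·⟩`. [folklore] -/
theorem hasFDerivAt_norm_sub_sq (y x : E) :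
    HasFDerivAt (fun z : E => ‖z - y‖ ^ 2) ((2 : ℝ) • innerSL ℝ (x - y)) x := by
  have h := ((hasFDerivAt_id x).sub_const y).norm_sq
  refine h.congr_fderiv ?_
  ext h
  simp [two_smul]

/-- The spatial derivative of the barrier slice `x ↦ (c₁ − |x − y|²)²/c₂`:
`−(4 (c₁ − |x − y|²)/c₂) ⟨x − y, ·⟩` (Lieberman 1996, proof of Lemma 2.6: `Dψ = −4ψ₁ψ₀^{-q} x`). [cite: Lieberman1996, Ch. II Lemma 2.6 (proof)] -/
theorem hasFDerivAt_paraboloidBarrier (y : E) (c₁ c₂ : ℝ) (x : E) :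
    HasFDerivAt (fun z : E => (c₁ - ‖z - y‖ ^ 2) ^ 2 / c₂)
      ((-(4 * (c₁ - ‖x - y‖ ^ 2) / c₂)) • innerSL ℝ (x - y)) x := by
  have hS : HasFDerivAt (fun z : E => c₁ - ‖z - y‖ ^ 2) (-((2 : ℝ) • innerSL ℝ (x - y))) x :=
    (hasFDerivAt_norm_sub_sq y x).const_sub c₁
  have hsq := hS.mul hS
  have hdiv : HasFDerivAt (fun z : E => c₂⁻¹ * ((c₁ - ‖z - y‖ ^ 2) * (c₁ - ‖z - y‖ ^ 2)))
      (c₂⁻¹ • ((c₁ - ‖x - y‖ ^ 2) • -((2 : ℝ) • innerSL ℝ (x - y)) +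
        (c₁ - ‖x - y‖ ^ 2) • -((2 : ℝ) • innerSL ℝ (x - y)))) x := hsq.const_mul c₂⁻¹
  have heq : (fun z : E => (c₁ - ‖z - y‖ ^ 2) ^ 2 / c₂) =
      fun z : E => c₂⁻¹ * ((c₁ - ‖z - y‖ ^ 2) * (c₁ - ‖z - y‖ ^ 2)) := by
    funext z; ring
  rw [heq]
  refine hdiv.congr_fderiv ?_
  ext h
  simp only [FunLike.coe_smul, Pi.smul_apply, smul_eq_mul, add_apply, neg_apply]
  ring

/-- The barrier slice is smooth in `x`. [folklore] -/
theorem contDiff_paraboloidBarrier (y : E) (c₁ c₂ : ℝ) {k : ℕ∞} :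
    ContDiff ℝ k (fun z : E => (c₁ - ‖z - y‖ ^ 2) ^ 2 / c₂) := by
  have h1 : ContDiff ℝ k fun z : E => ‖z - y‖ ^ 2 := (contDiff_id.sub contDiff_const).norm_sq ℝ
  exact ((contDiff_const.sub h1).pow 2).div_const c₂

/-- The second directional derivative of the barrier slice along `e`:
`D(Dψ e)(x) e = −(4/c₂) (−2⟨x − y, e⟩² + (c₁ − |x − y|²) |e|²)`. [cite: Lieberman1996, Ch. II Lemma 2.6 (proof)] -/
theorem hasFDerivAt_fderiv_paraboloidBarrier_apply (y : E) (c₁ c₂ : ℝ) (e x : E) :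
    HasFDerivAt (fun z : E => fderiv ℝ (fun w : E => (c₁ - ‖w - y‖ ^ 2) ^ 2 / c₂) z e)
      ((-(4 / c₂) * ⟪x - y, e⟫) • (-((2 : ℝ) • innerSL ℝ (x - y))) +
        (-(4 / c₂) * (c₁ - ‖x - y‖ ^ 2)) • innerSL ℝ e) x := by
  -- the first derivative in closed form, everywhere
  have hD : (fun z : E => fderiv ℝ (fun w : E => (c₁ - ‖w - y‖ ^ 2) ^ 2 / c₂) z e) =
      fun z : E => -(4 / c₂) * ((c₁ - ‖z - y‖ ^ 2) * ⟪z - y, e⟫) := by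
    funext z
    rw [(hasFDerivAt_paraboloidBarrier y c₁ c₂ z).fderiv]
    simp only [FunLike.coe_smul, Pi.smul_apply, innerSL_apply_apply, smul_eq_mul]
    ring
  rw [hD]
  have hS : HasFDerivAt (fun z : E => c₁ - ‖z - y‖ ^ 2) (-((2 : ℝ) • innerSL ℝ (x - y))) x :=
    (hasFDerivAt_norm_sub_sq y x).const_sub c₁
  have hI : HasFDerivAt (fun z : E => ⟪z - y, e⟫) (innerSL ℝ e) x := by
    have h1 : HasFDerivAt (fun z : E => ⟪e, z - y⟫)
        ((innerSL ℝ e).comp (ContinuousLinearMap.id ℝ E)) x :=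
      (innerSL ℝ e).hasFDerivAt.comp x ((hasFDerivAt_id x).sub_const y)
    have h2 : (fun z : E => ⟪z - y, e⟫) = fun z : E => ⟪e, z - y⟫ :=
      funext fun z => real_inner_comm _ _
    rw [h2]
    simpa using h1
  have hprod := (hS.mul hI).const_mul (-(4 / c₂))
  have hfun : (fun z : E => -(4 / c₂) * ((c₁ - ‖z - y‖ ^ 2) * ⟪z - y, e⟫)) =
      fun z : E => -(4 / c₂) * ((fun w : E => c₁ - ‖w - y‖ ^ 2) * fun w : E => ⟪w - y, e⟫) z := by
    funext z; rfl
  rw [hfun]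
  refine hprod.congr_fderiv ?_
  ext h
  simp only [FunLike.coe_smul, Pi.smul_apply, smul_eq_mul, add_apply, neg_apply,
    innerSL_apply_apply]
  ring

variable [FiniteDimensional ℝ E]

/-- **Laplacian of the barrier slice**: `Δ((c₁ − |x−y|²)²/c₂) = (8|x − y|² − 4n(c₁ − |x − y|²))/c₂`,
`n = dim E` (Lieberman 1996, proof of Lemma 2.6, the terms `8aⁱʲxᵢxⱼ − 4ψ₁𝒯` for `aⁱʲ = δⁱʲ`,
`𝒯 = n`). [cite: Lieberman1996, Ch. II Lemma 2.6 (proof)] -/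
theorem laplacian_paraboloidBarrier (y : E) (c₁ c₂ : ℝ) (x : E) :
    (Δ (fun z : E => (c₁ - ‖z - y‖ ^ 2) ^ 2 / c₂)) x =
      (8 * ‖x - y‖ ^ 2 - 4 * (Module.finrank ℝ E : ℝ) * (c₁ - ‖x - y‖ ^ 2)) / c₂ := by
  set b := stdOrthonormalBasis ℝ E
  rw [laplacian_eq_sum_fderiv_fderiv b (contDiff_paraboloidBarrier y c₁ c₂) x]
  have hterm : ∀ i,
      fderiv ℝ (fun z => fderiv ℝ (fun w : E => (c₁ - ‖w - y‖ ^ 2) ^ 2 / c₂) z (b i)) x (b i) =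
        -(4 / c₂) * (-2 * ⟪x - y, b i⟫ ^ 2 + (c₁ - ‖x - y‖ ^ 2)) := by
    intro i
    rw [(hasFDerivAt_fderiv_paraboloidBarrier_apply y c₁ c₂ (b i) x).fderiv]
    have hbi : ⟪b i, b i⟫ = (1 : ℝ) := by
      rw [real_inner_self_eq_norm_sq, b.orthonormal.1 i, one_pow]
    simp only [add_apply, FunLike.coe_smul, Pi.smul_apply, neg_apply, innerSL_apply_apply,
      smul_eq_mul, hbi]
    ring
  simp_rw [hterm]
  rw [← Finset.mul_sum, Finset.sum_add_distrib, Finset.sum_const, Finset.card_univ,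
    ← Module.finrank_eq_card_basis b.toBasis, nsmul_eq_mul, ← Finset.mul_sum,
    b.sum_sq_inner_left]
  field_simp
  ring

omit [FiniteDimensional ℝ E] in
/-- **Norm of the barrier gradient**: `‖Dψ(t,·)(x)‖ = 4 |c₁ − |x−y|²| |x − y| / |c₂|`. [cite: Lieberman1996, Ch. II Lemma 2.6 (proof)] -/
theorem norm_fderiv_paraboloidBarrier (y : E) (c₁ c₂ : ℝ) (x : E) :
    ‖fderiv ℝ (fun z : E => (c₁ - ‖z - y‖ ^ 2) ^ 2 / c₂) x‖ =
      |4 * (c₁ - ‖x - y‖ ^ 2) / c₂| * ‖x - y‖ := by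
  rw [(hasFDerivAt_paraboloidBarrier y c₁ c₂ x).fderiv, norm_smul, innerSL_apply_norm,
    Real.norm_eq_abs, abs_neg]

end Space

/-! ### Time derivative -/

section Time

/-- **Time derivative of the barrier** along `P(t) = p₀ + m (t − t_b)`: for fixed `r = |x − y|²`,
`∂ₜ[(P − r)²/P^q] = m (2(P − r) − q (P − r)²/P)/P^q` where `P(t) ≠ 0` (Lieberman 1996, proof of
Lemma 2.6, the terms `((1−ε²)/α)(qψ₁²/ψ₀ − 2ψ₁)`). [cite: Lieberman1996, Ch. II Lemma 2.6 (proof)] -/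
theorem hasDerivAt_paraboloidBarrier_time (p₀ m t_b r : ℝ) {q : ℕ} (hq : q ≠ 0) {t : ℝ}
    (hP : p₀ + m * (t - t_b) ≠ 0) :
    HasDerivAt (fun τ : ℝ => (p₀ + m * (τ - t_b) - r) ^ 2 / (p₀ + m * (τ - t_b)) ^ q)
      (m * (2 * (p₀ + m * (t - t_b) - r) -
          q * (p₀ + m * (t - t_b) - r) ^ 2 / (p₀ + m * (t - t_b))) /
        (p₀ + m * (t - t_b)) ^ q) t := by
  set P : ℝ → ℝ := fun τ => p₀ + m * (τ - t_b) with hPdef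
  have hPd : HasDerivAt P m t := by
    have h := ((hasDerivAt_id t).sub_const t_b).const_mul m |>.const_add p₀
    simpa [hPdef] using h
  have hN : HasDerivAt (fun τ => (P τ - r) ^ 2) ((2 : ℕ) * (P t - r) ^ (2 - 1) * m) t :=
    (hPd.sub_const r).pow 2
  have hD : HasDerivAt (fun τ => P τ ^ q) ((q : ℝ) * P t ^ (q - 1) * m) t := hPd.pow q
  have hD0 : P t ^ q ≠ 0 := pow_ne_zero _ hP
  have hdiv := hN.div hD hD0
  have hPt : P t = p₀ + m * (t - t_b) := rfl
  have hpow : P t ^ (q - 1) = P t ^ q / P t := by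
    rw [eq_div_iff hP, pow_sub_one_mul hq]
  refine hdiv.congr_deriv ?_
  rw [hpow]
  simp only [Nat.cast_ofNat, hPt]
  field_simp
  ring

end Time

/-! ### Lieberman's choice of `q`: the differential inequality inside the paraboloid -/

section Ineq

/-- **The algebra behind `Lψ ≥ 0`** (Lieberman 1996, proof of Lemma 2.6): with `S = P − |x−y|²`
(`0 ≤ S`, `P > 0`), `d = |x − y| ≤ R`, drift bound `A ≥ 0`, `F = 8 + 4n + 4AR + 2m` and
`F² ≤ 32 m q`, the time-derivative bracket is dominated by the Laplacian and drift brackets: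
`m(2S − qS²/P) ≤ (8(P − S) − 4nS) − A(4 S d)`, i.e. `Δψ − A|Dψ| − ∂ₜψ ≥ 0` after multiplying
by `P^{-q} > 0` (the quadratic `(mq/P)S² − FS + 8P` has nonpositive discriminant). [cite: Lieberman1996, Ch. II Lemma 2.6 (proof, choice of q)] -/
theorem paraboloidBarrier_ineq {P S d R A m n q : ℝ} (hP : 0 < P) (hS0 : 0 ≤ S)
    (hdR : d ≤ R) (hA : 0 ≤ A) (hq : (8 + 4 * n + 4 * A * R + 2 * m) ^ 2 ≤ 32 * m * q) :
    m * (2 * S - q * S ^ 2 / P) ≤ (8 * (P - S) - 4 * n * S) - A * (4 * S * d) := by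
  set F : ℝ := 8 + 4 * n + 4 * A * R + 2 * m with hF
  -- drift term: `A (4 S d) ≤ 4 A R S`
  have h1 : A * (4 * S * d) ≤ 4 * A * R * S := by nlinarith [mul_nonneg hA hS0]
  -- it suffices to bound the quadratic `8P − F S + m q S²/P ≥ 0`
  suffices h : 0 ≤ 8 * P - F * S + m * q * S ^ 2 / P by
    have hE : (8 * (P - S) - 4 * n * S) - 4 * A * R * S - m * (2 * S - q * S ^ 2 / P) =
        8 * P - F * S + m * q * S ^ 2 / P := by rw [hF]; ring
    linarith
  have hmq : 0 ≤ m * q := by nlinarith [sq_nonneg F]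
  -- multiply by `P > 0`
  have key : 0 ≤ 8 * P ^ 2 - F * S * P + m * q * S ^ 2 := by
    nlinarith [sq_nonneg (16 * P - F * S), sq_nonneg S, mul_nonneg hmq (sq_nonneg S)]
  have : 8 * P - F * S + m * q * S ^ 2 / P = (8 * P ^ 2 - F * S * P + m * q * S ^ 2) / P := by
    field_simp
  rw [this]
  positivity

end Ineq

end Literature.Analysis.FluidPDE

end
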